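import Summits.NavierStokesRegularity.NavierStokesRegularity.Theorems.PalasekTowerBreakdownEpisodeBaseStrainSliceH2Tools
import Summits.NavierStokesRegularity.NavierStokesRegularity.Theorems.PalasekTowerBreakdownEpisodeBaseAgmonExplicit

/-!
# The Hessian–Laplacian identity for smooth `L²` fields, and the explicit Agmon inequality in Laplacian form

Cell `ns-blowup`, seat `ns-palasek-19179-p2` (g6; `--supports stmt-NavierStokesRegularity-19179`; support for the
stub `stub_strain_door` of the line `Cruxes/EpisodeBase/Lines/straindoor.lean`). LABEL: E–C analysis (KERNEL:
theorems only; no definition, no named fact, no `sorry`; register-free). WHAT THIS IS NOT: not Navier–Stokes evidence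
— a calculus identity and a Sobolev inequality; nothing about any flow, design or blow-up.

The slice inequalities of this series (`…StrainSliceH1`, `…StrainSliceH2`) carry the dissipations `∫‖ΔW‖²`,
`∑ₗ∫‖Δ∂ₗW‖²` while the energies are the Frobenius sums `D₁ = ∑ₖ∫‖∂ₖW‖²`, `H = ∑ₗ∑ₖ∫‖∂ₖ∂ₗW‖²`, and the explicit
Agmon inequality (`AgmonExplicit.norm_le_agmon_explicit`) is stated with `H`. This file identifies the two currencies:

* `integral_norm_laplacian_sq_eq_sum_sum` — for a smooth `L²` field `W` on any finite-dimensional real inner product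
  space: `∫‖ΔW‖² = ∑ₗ∑ₖ ∫‖∂ₖ∂ₗW‖²` (two integrations by parts: `∫⟪ΔW, ΔW⟫ = −∑ₖ∫⟪∂ₖΔW, ∂ₖW⟫`, `∂ₖΔ = Δ∂ₖ`, and
  `∫⟪V, ΔV⟫ = −∑ₗ∫‖∂ₗV‖²`);
* `norm_le_agmon_explicit_laplacian` — in dimension three, `‖v x‖ ≤ (√2/π) · (∑ₖ∫‖∂ₖv‖²)^{1/4} · (∫‖Δv‖²)^{1/4}`
  (written with square roots): the tree's `IsSmoothL2Field.norm_le_agmon_laplacian` with `agmonConst` replaced by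
  the number `√2/π < 0.4502`.

References: E. M. Stein, G. Weiss, Princeton 1971, Ch. I Thm. 2.3 [cite: SteinWeiss1971, Ch. I Thm. 2.3]; J. C. Robinson,
J. L. Rodrigo, W. Sadowski, CUP 2016, Thm. 1.20 [cite: RobinsonRodrigoSadowski2016, Thm. 1.20].
-/

noncomputable section

set_option linter.dupNamespace false

open MeasureTheory Filter Function Set
open scoped ENNReal NNReal RealInnerProductSpace Topology Laplacian
open Literature.Analysis.FunctionSpaces Literature.Analysis.FluidPDE

namespace Summit.NavierStokesRegularity.NavierStokesRegularity.Theorems.StrainPairing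

variable {E : Type*} [NormedAddCommGroup E] [InnerProductSpace ℝ E] [FiniteDimensional ℝ E]
  [MeasurableSpace E] [BorelSpace E]
variable {E' : Type*} [NormedAddCommGroup E'] [InnerProductSpace ℝ E'] [FiniteDimensional ℝ E']

/-- **Hessian–Laplacian identity**: `∫‖ΔW‖² = ∑ₗ∑ₖ ∫‖∂ₖ∂ₗW‖²` for a smooth `L²` field.
[cite: SteinWeiss1971, Ch. I Thm. 2.3] -/
theorem integral_norm_laplacian_sq_eq_sum_sum {W : E → E'} (hW : IsSmoothL2Field W) :
    ∫ x, ‖(Δ W) x‖ ^ 2 =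
      ∑ l, ∑ k, ∫ x, ‖fderiv ℝ (fun y => fderiv ℝ W y (stdOrthonormalBasis ℝ E l)) x (stdOrthonormalBasis ℝ E k)‖ ^ 2 := by
  have hW3 : ContDiff ℝ 3 W := hW.contDiff_nat 3
  have hΔ : IsSmoothL2Field (Δ W) := hW.laplacian
  have hV : ∀ l, IsSmoothL2Field (fun y => fderiv ℝ W y (stdOrthonormalBasis ℝ E l)) := fun l => hW.fderiv_apply (stdOrthonormalBasis ℝ E l)
  -- `∫‖ΔW‖² = ∫⟪ΔW, ΔW⟫ = −∑ₗ ∫⟪∂ₗΔW, ∂ₗW⟫`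
  have h1 : ∫ x, ‖(Δ W) x‖ ^ 2 = ∫ x, ⟪(Δ W) x, (Δ W) x⟫ :=
    integral_congr_ae (Eventually.of_forall fun x => (real_inner_self_eq_norm_sq _).symm)
  rw [h1, integral_inner_laplacian_eq_neg_sum hΔ hW]
  rw [← Finset.sum_neg_distrib]
  refine Finset.sum_congr rfl fun l _ => ?_
  -- `∂ₗΔW = Δ∂ₗW`, then `∫⟪ΔV, V⟫ = −∑ₖ‖∂ₖV‖²` for `V = ∂ₗW`
  have h2 : ∀ x, fderiv ℝ (Δ W) x (stdOrthonormalBasis ℝ E l) = (Δ (fun y => fderiv ℝ W y (stdOrthonormalBasis ℝ E l))) x :=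
    fun x => fderiv_apply_laplacian_eq hW3 x (stdOrthonormalBasis ℝ E l)
  simp_rw [h2]
  have h3 : ∫ x, ⟪(Δ (fun y => fderiv ℝ W y (stdOrthonormalBasis ℝ E l))) x, fderiv ℝ W x (stdOrthonormalBasis ℝ E l)⟫ =
      ∫ x, ⟪(fun y => fderiv ℝ W y (stdOrthonormalBasis ℝ E l)) x, (Δ (fun y => fderiv ℝ W y (stdOrthonormalBasis ℝ E l))) x⟫ :=
    integral_congr_ae (Eventually.of_forall fun x => real_inner_comm _ _)
  rw [h3, (hV l).integral_inner_laplacian, neg_neg]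

/-- **The explicit Agmon inequality in Laplacian form** (dimension three): for a smooth `L²` field `v : E → F`,
`‖v x‖ ≤ (√2/π) · √( √(∑ₖ∫‖∂ₖv‖²) · √(∫‖Δv‖²) )`. [cite: RobinsonRodrigoSadowski2016, Thm. 1.20]
[cite: SteinWeiss1971, Ch. I Thm. 2.3] -/
theorem norm_le_agmon_explicit_laplacian (h3 : Module.finrank ℝ E = 3) {F : Type*} [NormedAddCommGroup F]
    [InnerProductSpace ℝ F] [FiniteDimensional ℝ F] {v : E → F} (hv : IsSmoothL2Field v) (x : E) :
    ‖v x‖ ≤ Real.sqrt 2 / Real.pi *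
      Real.sqrt (Real.sqrt (∑ i, ∫ y, ‖fderiv ℝ v y (stdOrthonormalBasis ℝ E i)‖ ^ 2) *
        Real.sqrt (∫ y, ‖(Δ v) y‖ ^ 2)) := by
  rw [integral_norm_laplacian_sq_eq_sum_sum hv, Finset.sum_comm]
  exact AgmonExplicit.norm_le_agmon_explicit h3 hv x

end Summit.NavierStokesRegularity.NavierStokesRegularity.Theorems.StrainPairing

end
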